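import Mathlib
import Summits.Ventures.PercRepro2.SwOutCrossJunctionDefs
import Summits.Ventures.PercRepro2.SwOutJunctionH1Kinds

/-!
# The cross junction at a core-kind class point: the two sides (blind cell PercRepro2, night-4
g24, 2026-08-28; proofs/NIGHT4-G24.md §2)

At a `Q`-point `ζ` of the class with `u` in the hull of `h` and the hull of `u` inside `U` (the
CORE KIND): the component of a dropped vertex in `G[H⁺ ∖ {h, u}]` consists of dropped vertices
(`armC_p_subset`); the two edges of a neighbour of `u` adjacent to `h` have the same colour
(`u_edge_eq_h_edge`: both red or both blue — otherwise the vertex would lie on both sides); the red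
cluster of `u` lies in the red cluster of `h` with `u` and the dropped vertices
(`cluster_u_subset`), so every arm vertex lies in the hull of `h` (`mem_hull_of_mem_arm`); the
core of `h` is `{h, u}` (`eq_h_or_u_of_core`); the mark is in no cluster of `h` or `u`; and a
core-kind point has a u-arm (`exists_uArmsX`).
-/

namespace Summit.Ventures.PercRepro2

namespace CrossArm

open Hull LocRows

variable {V : Type*} {E : Type*} [Fintype E] [DecidableEq E]

open scoped Classical

variable {ends : E → Sym2 V} {X : Type*} {U : Set V} {ξ : Config E} {l h o u : V} {p : X → V}
  {G : SimpleGraph X}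

section Sides

variable (hj : CrossJunction ends U h u p G o) (hl : l ∉ U) {ζ : Config E}
  (hζ : ζ ∈ swOutSide ends l h o U ξ) (hk : CoreKind ends U h u ζ)
include hj hl hζ hk

omit hj hl hk in
/-- The mark is not in the red cluster of `h`. -/
lemma o_notMem_cluster_h : o ∉ cluster ends ζ h := by
  intro ho
  have hQ := (mem_tgtU_iff'.1 (mem_swOutSide.1 hζ).1)
  exact hQ.1 (Or.inl (conn_trans hQ.2.1 (conn_symm ho)))

omit hj in
/-- The mark is not in the red cluster of `u`. -/
lemma o_notMem_cluster_u : o ∉ cluster ends ζ u := by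
  intro ho
  have hQ := (mem_tgtU_iff'.1 (mem_swOutSide.1 hζ).1)
  exact (u_notMem_cluster_l_of_coreKind hl hk).1 (conn_trans hQ.2.1 (conn_symm ho))

/-- The two sides are disjoint. -/
lemma CrossJunction.sides_disjoint (x : V) (hxR : x ∈ redExt ends h u ζ)
    (hxB : x ∈ blueExt ends ζ h u) : False :=
  redExt_disjoint_blueExt hl hj.hout hζ hk x hxR hxB

omit hl hζ hk in
omit [Fintype E] [DecidableEq E] in
/-- The arm of a dropped vertex consists of dropped vertices. -/
lemma CrossJunction.armC_p_subset (hHU : extHull ends ζ h u ⊆ U) (i : X) {x : V}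
    (hx : x ∈ armC ends h u ζ (p i)) : ∃ j, x = p j := by
  refine mem_of_conn_of_closed (ends := ends) (ω := armConfigC ends h u ζ)
    (S := {v | ∃ j, v = p j}) ?_ ⟨i, rfl⟩ hx
  rintro a ⟨j, rfl⟩ b hab
  obtain ⟨_, e, he, hends⟩ := openGraph_adj.1 hab
  rw [armConfigC_eq_true_iff] at he
  obtain ⟨x', hx', y', hy', hxy'⟩ := he
  have hbH : b ∈ extHull ends ζ h u ∧ b ≠ h ∧ b ≠ u := by
    rw [hends, Sym2.eq_iff] at hxy'
    rcases hxy' with ⟨-, h2⟩ | ⟨-, h2⟩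
    · rw [← h2] at hy'
      exact ⟨hy'.1, fun h' => hy'.2 (by rw [h']; exact Or.inl rfl),
        fun h' => hy'.2 (by rw [h']; exact Or.inr rfl)⟩
    · rw [← h2] at hx'
      exact ⟨hx'.1, fun h' => hx'.2 (by rw [h']; exact Or.inl rfl),
        fun h' => hx'.2 (by rw [h']; exact Or.inr rfl)⟩
  rcases hj.hp_in j e b hends (hHU hbH.1) with hbu | hbp
  · exact absurd hbu hbH.2.2
  · exact hbp

/-- **The two edges of a neighbour of `u` adjacent to `h` have the same colour.** -/
lemma CrossJunction.u_edge_eq_h_edge {e e' : E} {x : V} (he : ends e = s(u, x))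
    (he' : ends e' = s(x, h)) : ζ e = ζ e' := by
  have hxu : x ≠ u := fun h' => hj.hloop_u e (by rw [he, h', Sym2.eq_swap])
  have hxh : x ≠ h := fun h' => hj.hnadj e (by rw [he, h', Sym2.eq_swap])
  by_cases hxo : x = o
  · subst hxo
    have h1 : ζ e = false := by
      cases hc : ζ e with
      | false => rfl
      | true =>
        exact absurd (mem_cluster_of_edge (mem_cluster_self _ _ _) hc he)
          (o_notMem_cluster_u hl hζ hk)
    have h2 : ζ e' = false := by
      cases hc : ζ e' with
      | false => rfl
      | true =>
        exact absurd (mem_cluster_of_edge (mem_cluster_self _ _ _) hc (ends_swap he'))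
          (o_notMem_cluster_h hζ)
    rw [h1, h2]
  · by_contra hne
    cases hc : ζ e with
    | true =>
      have hc' : ζ e' = false := by
        cases hc'' : ζ e' with
        | false => rfl
        | true => exact absurd (by rw [hc, hc'']) hne
      have hb : blue ζ e' = true := by rw [blue_eq_true_iff]; exact hc'
      exact hj.sides_disjoint hl hζ hk x
        (mem_redExt_iff.2 ⟨Or.inr (mem_cluster_of_edge (mem_cluster_self _ _ _) hc he), hxh, hxu⟩)
        (mem_blueExt_iff.2 ⟨Or.inl (mem_cluster_of_edge (mem_cluster_self _ _ _) hb (ends_swap he')),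
          hxh, hxu⟩)
    | false =>
      have hc' : ζ e' = true := by
        cases hc'' : ζ e' with
        | true => rfl
        | false => exact absurd (by rw [hc, hc'']) hne
      have hb : blue ζ e = true := by rw [blue_eq_true_iff]; exact hc
      exact hj.sides_disjoint hl hζ hk x
        (mem_redExt_iff.2 ⟨Or.inl (mem_cluster_of_edge (mem_cluster_self _ _ _) hc' (ends_swap he')),
          hxh, hxu⟩)
        (mem_blueExt_iff.2 ⟨Or.inr (mem_cluster_of_edge (mem_cluster_self _ _ _) hb he), hxh, hxu⟩)

/-- **The red cluster of `u` lies in the red cluster of `h` with `u` and the dropped vertices.** -/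
lemma CrossJunction.cluster_u_subset {x : V} (hx : x ∈ cluster ends ζ u) :
    x ∈ cluster ends ζ h ∨ x = u ∨ ∃ i, x = p i := by
  have hHU : extHull ends ζ h u ⊆ U := extHull_subset_of_coreKind hζ hk
  have key : x ∈ {v | v ∈ cluster ends ζ u ∧ (v ∈ cluster ends ζ h ∨ v = u ∨ ∃ i, v = p i)} := by
    refine mem_of_conn_of_closed (ends := ends) (ω := ζ) ?_ ⟨mem_cluster_self _ _ _, Or.inr (Or.inl rfl)⟩ hx
    rintro a ⟨hau, ha⟩ b hab
    obtain ⟨_, e, he, hends⟩ := openGraph_adj.1 hab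
    refine ⟨mem_cluster_of_edge hau he hends, ?_⟩
    rcases ha with hah | rfl | ⟨i, rfl⟩
    · exact Or.inl (mem_cluster_of_edge hah he hends)
    · -- from `u`: a dropped vertex, or a neighbour adjacent to `h` with a red h-edge
      by_cases hbp : ∃ i, b = p i
      · exact Or.inr (Or.inr hbp)
      · have hbp' : ∀ i, b ≠ p i := fun i h' => hbp ⟨i, h'⟩
        obtain ⟨e', he'⟩ := hj.hu_adj_h e b hends hbp'
        have hc := hj.u_edge_eq_h_edge hl hζ hk hends he'
        rw [he] at hc
        exact Or.inl (mem_cluster_of_edge (mem_cluster_self _ _ _) hc.symm (ends_swap he'))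
    · -- from a dropped vertex: `u` or a dropped vertex (the cluster lies in `U`)
      have hbU : b ∈ U := hk.2 (Or.inl (mem_cluster_of_edge hau he hends))
      rcases hj.hp_in i e b hends hbU with hbu | hbp
      · exact Or.inr (Or.inl hbu)
      · exact Or.inr (Or.inr hbp)
  exact key.2

/-- The blue cluster of `u` lies in the blue cluster of `h` with `u` and the dropped vertices. -/
lemma CrossJunction.cluster_blue_u_subset {x : V} (hx : x ∈ cluster ends (blue ζ) u) :
    x ∈ cluster ends (blue ζ) h ∨ x = u ∨ ∃ i, x = p i := by
  have hHU : extHull ends ζ h u ⊆ U := extHull_subset_of_coreKind hζ hk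
  have key : x ∈ {v | v ∈ cluster ends (blue ζ) u ∧
      (v ∈ cluster ends (blue ζ) h ∨ v = u ∨ ∃ i, v = p i)} := by
    refine mem_of_conn_of_closed (ends := ends) (ω := blue ζ) ?_
      ⟨mem_cluster_self _ _ _, Or.inr (Or.inl rfl)⟩ hx
    rintro a ⟨hau, ha⟩ b hab
    obtain ⟨_, e, he, hends⟩ := openGraph_adj.1 hab
    refine ⟨mem_cluster_of_edge hau he hends, ?_⟩
    rcases ha with hah | rfl | ⟨i, rfl⟩
    · exact Or.inl (mem_cluster_of_edge hah he hends)
    · by_cases hbp : ∃ i, b = p i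
      · exact Or.inr (Or.inr hbp)
      · have hbp' : ∀ i, b ≠ p i := fun i h' => hbp ⟨i, h'⟩
        obtain ⟨e', he'⟩ := hj.hu_adj_h e b hends hbp'
        have hc := hj.u_edge_eq_h_edge hl hζ hk hends he'
        have he1 : ζ e = false := blue_eq_true_iff.1 he
        have he2 : blue ζ e' = true := by rw [blue_eq_true_iff, ← hc, he1]
        exact Or.inl (mem_cluster_of_edge (mem_cluster_self _ _ _) he2 (ends_swap he'))
    · have hbU : b ∈ U := hk.2 (Or.inr (mem_cluster_of_edge hau he hends))
      rcases hj.hp_in i e b hends hbU with hbu | hbp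
      · exact Or.inr (Or.inl hbu)
      · exact Or.inr (Or.inr hbp)
  exact key.2

/-- A vertex of the extended hull other than `u` and the dropped vertices lies in the hull of
`h`. -/
lemma CrossJunction.mem_hull_of_mem_extHull {x : V} (hx : x ∈ extHull ends ζ h u) (hxu : x ≠ u)
    (hxp : ∀ i, x ≠ p i) : x ∈ hull ends ζ h := by
  rcases hx with hx | hx | hx
  · exact hx
  · rcases hj.cluster_u_subset hl hζ hk hx with h' | h' | ⟨i, h'⟩
    · exact Or.inl h'
    · exact absurd h' hxu
    · exact absurd h' (hxp i)
  · rcases hj.cluster_blue_u_subset hl hζ hk hx with h' | h' | ⟨i, h'⟩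
    · exact Or.inr h'
    · exact absurd h' hxu
    · exact absurd h' (hxp i)

/-- A vertex of an arm without dropped vertices lies in the hull of `h`. -/
lemma CrossJunction.mem_hull_of_mem_arm {P : Set V} (hP : P ∈ armsC ends h u ζ)
    (hPp : ∀ i, p i ∉ P) {x : V} (hx : x ∈ P) : x ∈ hull ends ζ h :=
  hj.mem_hull_of_mem_extHull hl hζ hk (armsC_subset hP x hx).1 (armsC_subset hP x hx).2.2
    fun i h' => hPp i (h' ▸ hx)

/-- **The core of `h` is `{h, u}`.** -/
lemma CrossJunction.eq_h_or_u_of_core {x : V} (hxR : x ∈ cluster ends ζ h)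
    (hxB : x ∈ cluster ends (blue ζ) h) : x = h ∨ x = u := by
  by_contra hne
  have hne1 : x ≠ h := fun h' => hne (Or.inl h')
  have hne2 : x ≠ u := fun h' => hne (Or.inr h')
  exact hj.sides_disjoint hl hζ hk x (mem_redExt_iff.2 ⟨Or.inl hxR, hne1, hne2⟩)
    (mem_blueExt_iff.2 ⟨Or.inl hxB, hne1, hne2⟩)

omit hl in
/-- The arm of a vertex that is not a dropped vertex contains no dropped vertex. -/
lemma CrossJunction.p_notMem_armC {x : V} (hxp : ∀ i, x ≠ p i) (i : X) :
    p i ∉ armC ends h u ζ x := by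
  intro hpx
  have hHU : extHull ends ζ h u ⊆ U := extHull_subset_of_coreKind hζ hk
  have hxpi : x ∈ armC ends h u ζ (p i) := by
    rw [armC_eq_of_mem hpx]; exact mem_armC_self x
  obtain ⟨j, hj'⟩ := hj.armC_p_subset hHU i hxpi
  exact hxp j hj'

omit hl in
/-- **A core-kind point has a u-arm**: `u` is reached from `h` through a neighbour adjacent to
`h`. -/
lemma CrossJunction.exists_uArmsX : ∃ P, P ∈ uArmsX ends h u p ζ := by
  have hHU : extHull ends ζ h u ⊆ U := extHull_subset_of_coreKind hζ hk
  -- a neighbour of `u` adjacent to `h`, in the hull of `h`, not a dropped vertex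
  have key : ∃ e x, ends e = s(u, x) ∧ (∀ i, x ≠ p i) ∧ x ∈ extHull ends ζ h u := by
    have good : ∀ (ω : Config E), ω = ζ ∨ ω = blue ζ → u ∈ cluster ends ω h →
        ∃ e x, ends e = s(u, x) ∧ (∀ i, x ≠ p i) ∧ x ∈ cluster ends ω h := by
      intro ω hω hu
      have hsub : cluster ends ω h ⊆ U := by
        intro v hv
        rcases hω with rfl | rfl
        · exact (mem_outClass.1 (mem_swOutSide.1 hζ).2).2 (Or.inl hv)
        · exact (mem_outClass.1 (mem_swOutSide.1 hζ).2).2 (Or.inr hv)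
      have hcl : u ∈ {v | v ∈ cluster ends ω h ∧ ((v = u ∨ ∃ i, v = p i) →
          ∃ e x, ends e = s(u, x) ∧ (∀ i, x ≠ p i) ∧ x ∈ cluster ends ω h)} := by
        refine mem_of_conn_of_closed (ends := ends) (ω := ω) ?_
          ⟨mem_cluster_self _ _ _, fun h' => ?_⟩ hu
        · rintro a ⟨ha, hgood⟩ b hab
          obtain ⟨_, e, he, hends⟩ := openGraph_adj.1 hab
          refine ⟨mem_cluster_of_edge ha he hends, ?_⟩
          rintro (rfl | ⟨j, rfl⟩)
          · -- the edge ends at `u`: `a` is a neighbour of `u`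
            by_cases hap : ∃ i, a = p i
            · exact hgood (Or.inr hap)
            · exact ⟨e, a, ends_swap hends, fun i h' => hap ⟨i, h'⟩, ha⟩
          · -- the edge ends at a dropped vertex: `a` is `u` or a dropped vertex
            have haU : a ∈ U := hsub ha
            rcases hj.hp_in j e a (ends_swap hends) haU with rfl | hap
            · exact hgood (Or.inl rfl)
            · exact hgood (Or.inr hap)
        · rcases h' with h' | ⟨i, h'⟩
          · exact absurd h' hj.hne_hu
          · exact absurd h' (hj.hne_hp i)
      exact hcl.2 (Or.inl rfl)
    rcases hk.1 with hu | hu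
    · obtain ⟨e, x, hex, hxp, hx⟩ := good ζ (Or.inl rfl) hu
      exact ⟨e, x, hex, hxp, Or.inl (Or.inl hx)⟩
    · obtain ⟨e, x, hex, hxp, hx⟩ := good (blue ζ) (Or.inr rfl) hu
      exact ⟨e, x, hex, hxp, Or.inl (Or.inr hx)⟩
  obtain ⟨e, x, hex, hxp, hxH⟩ := key
  have hxu : x ≠ u := fun h' => hj.hloop_u e (by rw [hex, h', Sym2.eq_swap])
  have hxh : x ≠ h := fun h' => hj.hnadj e (by rw [hex, h', Sym2.eq_swap])
  refine ⟨armC ends h u ζ x, mem_uArmsX_iff.2 ⟨armC_mem_armsC hj.hne_hu hxH hxh hxu (Or.inr hex),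
    fun i => hj.p_notMem_armC hζ hk hxp i, e, x, hex, mem_armC_self x⟩⟩

end Sides

end CrossArm

end Summit.Ventures.PercRepro2
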